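import Summits.KontsevichZagierPeriods.KontsevichZagierPeriods.Theses.UnfoldedStokes
import Literature.NumberTheory.Transcendental.KZCalculusProofs
import Literature.NumberTheory.Transcendental.KZCubicalCalculus

/-!
# `StokesGeneration` (stmt-KontsevichZagierPeriods-3586) — Newton–Leibniz is load-bearing

cdisprove (refuter) negative lemmas for the crux `StokesGeneration` of route
`KontsevichZagierPeriods/UnfoldedStokes`
(`ker eval ≤ relations ⊔ closure S`, `S` the unfolded-Stokes square relators).

The additive invariant `ψ : FormalRep →+ ℝ`, "value of the dimension-`0` part"
(`[r] ↦ value r` if `r : IntegralRep 0`, else `0`; it exists, `exists_dimZeroValue`) vanishes on every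
move that stays inside one dimension — domain additivity, integrand additivity, change of variables
(by the soundness of each of these moves in dimension `0`) — and on every square relator
(dimensions `2`, `3`), but takes the value `−1` on the kernel element `w = [[0,1]¹, 1] − [pt, 1]`.
Consequences (all sorry-free, theorems only):

* `stokesGeneration_false_without_NL` — the crux with the Newton–Leibniz move set removed from the
  generators of `relations` (both additivities, change of variables AND the square relators kept) is
  FALSE: any proof of the crux must use rule 3) to connect dimensions;
* `stokesGeneration_false_without_relations` — the square relators alone do not generate `ker eval`;
* `newtonLeibniz_loadBearing` — `¬ ker eval ≤ closure (domainAddRel ∪ integrandAddRel ∪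
  changeOfVariablesRel)`: rule 3) cannot be dropped from Kontsevich–Zagier's list (tightness of the
  calculus of `KZCalculus.lean`).

[Kontsevich–Zagier 2001, §1.1 (`ℝ⁰` is a point of volume `1`), §1.2 rules (1)–(3)]
-/

noncomputable section

namespace Summit.KontsevichZagierPeriods.UnfoldedStokes.StokesGenerationNegative

open MeasureTheory Set
open Literature.NumberTheory.Transcendental
open Literature.NumberTheory.Transcendental.KZ
open Literature.ModelTheory.ExponentialFields (IsSemialgebraic)

/-! ## Witnesses: the constant-one cube representations `[[0,1]ⁿ, 1]` -/

/-- For every `n` there is a representation on the closed unit cube `[0,1]ⁿ` with integrand `1`, of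
value `1` (for `n = 0`: the point representation `[pt, 1]`). [cite: KontsevichZagier2001, §1.1] -/
theorem exists_rep_value_one (n : ℕ) : ∃ r : IntegralRep n, r.value = 1 := by
  refine ⟨IntegralRep.tameCube (fun _ => (1 : ℝ)) (fun _ _ => analyticAt_const)
    ((isSemialgebraicFunOn_natCast isSemialgebraic_cube 1).congr fun _ _ => by simp), ?_⟩
  simp [IntegralRep.value, IntegralRep.tameCube]

/-- **The kernel element** `w = [r₁] − [r₀]` with `r₁ : IntegralRep 1`, `r₀ : IntegralRep 0` both of
value `1`: `eval w = 0`. [folklore] -/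
theorem exists_kernel_witness :
    ∃ (r₁ : IntegralRep 1) (r₀ : IntegralRep 0), r₁.value = 1 ∧ r₀.value = 1 ∧
      eval (of r₁ - of r₀) = 0 := by
  obtain ⟨r₁, h₁⟩ := exists_rep_value_one 1
  obtain ⟨r₀, h₀⟩ := exists_rep_value_one 0
  exact ⟨r₁, r₀, h₁, h₀, by simp [h₁, h₀]⟩

/-! ## The invariant: value of the dimension-zero part -/

/-- **The invariant exists**: an additive `ψ : FormalRep →+ ℝ` with `ψ [r] = value r` on
dimension-`0` generators and `ψ [r] = 0` on all others (the free abelian group's universal property).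
[folklore] -/
theorem exists_dimZeroValue :
    ∃ ψ : FormalRep →+ ℝ, ∀ (n : ℕ) (r : IntegralRep n), ψ (of r) = if n = 0 then r.value else 0 :=
  ⟨FreeAbelianGroup.lift fun r : (Σ n, IntegralRep n) => if r.1 = 0 then r.2.value else 0,
    fun _ _ => FreeAbelianGroup.lift_apply_of _ _⟩

section Invariant

variable (ψ : FormalRep →+ ℝ)
  (hψ : ∀ (n : ℕ) (r : IntegralRep n), ψ (of r) = if n = 0 then r.value else 0)
include hψ

/-- `ψ ([r₁] − [r₀]) = −1` on the kernel witness. [folklore] -/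
theorem dimZeroValue_witness (r₁ : IntegralRep 1) (r₀ : IntegralRep 0) (h₀ : r₀.value = 1) :
    ψ (of r₁ - of r₀) = -1 := by
  simp [hψ, h₀]

/-- `ψ` kills domain additivity (the three representations share one dimension; soundness of the move
in dimension `0`). [cite: KontsevichZagier2001, §1.2 rule (1)] -/
theorem dimZeroValue_eq_zero_of_mem_domainAddRel {c : FormalRep} (hc : c ∈ domainAddRel) :
    ψ c = 0 := by
  have h0 : eval c = 0 := eval_eq_zero_of_mem_domainAddRel_holds hc
  obtain ⟨n, r, r₁, r₂, -, -, -, -, rfl⟩ := hc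
  simp only [map_sub, eval_of] at h0
  by_cases hn : n = 0
  · subst hn
    simp only [map_sub, hψ, if_true]
    exact h0
  · simp [hψ, hn]

/-- `ψ` kills integrand additivity. [cite: KontsevichZagier2001, §1.2 rule (1)] -/
theorem dimZeroValue_eq_zero_of_mem_integrandAddRel {c : FormalRep} (hc : c ∈ integrandAddRel) :
    ψ c = 0 := by
  have h0 : eval c = 0 := eval_eq_zero_of_mem_integrandAddRel_holds hc
  obtain ⟨n, r, r₁, r₂, -, -, -, rfl⟩ := hc
  simp only [map_sub, eval_of] at h0
  by_cases hn : n = 0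
  · subst hn
    simp only [map_sub, hψ, if_true]
    exact h0
  · simp [hψ, hn]

/-- `ψ` kills change of variables. [cite: KontsevichZagier2001, §1.2 rule (2)] -/
theorem dimZeroValue_eq_zero_of_mem_changeOfVariablesRel {c : FormalRep}
    (hc : c ∈ changeOfVariablesRel) : ψ c = 0 := by
  have h0 : eval c = 0 := eval_eq_zero_of_mem_changeOfVariablesRel_holds hc
  obtain ⟨n, r, r', Φ, Φ', -, -, -, -, -, rfl⟩ := hc
  simp only [map_sub, eval_of] at h0
  by_cases hn : n = 0
  · subst hn
    simp only [map_sub, hψ, if_true]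
    exact h0
  · simp [hψ, hn]

/-- `ψ` kills the subgroup generated by the THREE dimension-preserving move sets
(rules (1a), (1b), (2)). [folklore] -/
theorem closure_threeMoves_le_ker :
    AddSubgroup.closure (domainAddRel ∪ integrandAddRel ∪ changeOfVariablesRel) ≤ ψ.ker := by
  refine (AddSubgroup.closure_le _).mpr ?_
  rintro c ((hc | hc) | hc) <;> simp only [SetLike.mem_coe, AddMonoidHom.mem_ker]
  · exact dimZeroValue_eq_zero_of_mem_domainAddRel ψ hψ hc
  · exact dimZeroValue_eq_zero_of_mem_integrandAddRel ψ hψ hc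
  · exact dimZeroValue_eq_zero_of_mem_changeOfVariablesRel ψ hψ hc

/-- `ψ` kills every unfolded-Stokes square relator of the crux (all six representations live in
dimensions `2` and `3`; the set is the crux's, verbatim). [folklore] -/
theorem closure_stokesSquareRel_le_ker :
    AddSubgroup.closure {d : FormalRep | ∃ (U : Set (Fin 2 → ℝ)) (a b c e : (Fin 2 → ℝ) → ℝ)
      (rB rR rT rL rW : IntegralRep 2) (rD : IntegralRep 3),
      (IsOpen U) ∧ (Set.Icc (0 : Fin 2 → ℝ) 1 ⊆ U) ∧ (∀ p ∈ U, ∀ u ∈ Set.Icc (0 : ℝ) 1, u • p ∈ U) ∧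
      (ContDiffOn ℝ 1 a U) ∧ (ContDiffOn ℝ 1 b U) ∧ (ContDiffOn ℝ 1 c U) ∧ (ContDiffOn ℝ 1 e U) ∧
      (∀ p ∈ U, fderiv ℝ a p (Pi.single 1 1) = fderiv ℝ b p (Pi.single 0 1)) ∧
      (IsSemialgebraicFunOn ℚ U a) ∧ (IsSemialgebraicFunOn ℚ U b) ∧ (IsSemialgebraicFunOn ℚ U c) ∧
      (IsSemialgebraicFunOn ℚ U e) ∧
      (IsSemialgebraicFunOn ℚ U (fun p => fderiv ℝ a p (Pi.single 0 1))) ∧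
      (IsSemialgebraicFunOn ℚ U (fun p => fderiv ℝ a p (Pi.single 1 1))) ∧
      (IsSemialgebraicFunOn ℚ U (fun p => fderiv ℝ b p (Pi.single 1 1))) ∧
      (IsSemialgebraicFunOn ℚ U (fun p => fderiv ℝ c p (Pi.single 1 1))) ∧
      (IsSemialgebraicFunOn ℚ U (fun p => fderiv ℝ e p (Pi.single 0 1))) ∧
      (rB.domain = {x | ∀ i, x i ∈ Set.Ioo (0 : ℝ) 1}) ∧
      (Set.EqOn rB.integrand (fun x => x 0 * a ![x 1 * x 0, 0] * c ![x 0, 0]) rB.domain) ∧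
      (rR.domain = {x | ∀ i, x i ∈ Set.Ioo (0 : ℝ) 1}) ∧
      (Set.EqOn rR.integrand (fun x => (a ![x 1, x 1 * x 0] + x 0 * b ![x 1, x 1 * x 0]) * e ![1, x 0])
        rR.domain) ∧
      (rT.domain = {x | ∀ i, x i ∈ Set.Ioo (0 : ℝ) 1}) ∧
      (Set.EqOn rT.integrand (fun x => (x 0 * a ![x 1 * x 0, x 1] + b ![x 1 * x 0, x 1]) * c ![x 0, 1])
        rT.domain) ∧
      (rL.domain = {x | ∀ i, x i ∈ Set.Ioo (0 : ℝ) 1}) ∧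
      (Set.EqOn rL.integrand (fun x => x 0 * b ![0, x 1 * x 0] * e ![0, x 0]) rL.domain) ∧
      (rW.domain = {x | ∀ i, x i ∈ Set.Ioo (0 : ℝ) 1}) ∧
      (Set.EqOn rW.integrand (fun x => a ![x 0, x 1] * e ![x 0, x 1] - b ![x 0, x 1] * c ![x 0, x 1])
        rW.domain) ∧
      (rD.domain = {x | ∀ i, x i ∈ Set.Ioo (0 : ℝ) 1}) ∧
      (Set.EqOn rD.integrand (fun x => (x 0 * a ![x 2 * x 0, x 2 * x 1] + x 1 * b ![x 2 * x 0, x 2 * x 1]) *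
        (fderiv ℝ e ![x 0, x 1] (Pi.single 0 1) - fderiv ℝ c ![x 0, x 1] (Pi.single 1 1))) rD.domain) ∧
      d = of rB + of rR - of rT - of rL - of rW - of rD} ≤ ψ.ker := by
  refine (AddSubgroup.closure_le _).mpr ?_
  rintro d ⟨U, a, b, c, e, rB, rR, rT, rL, rW, rD, -, -, -, -, -, -, -, -, -, -, -, -, -, -, -, -, -,
    -, -, -, -, -, -, -, -, -, -, -, -, rfl⟩
  simp [hψ]

end Invariant

/-! ## The negative lemmas -/

/-- **Newton–Leibniz is load-bearing for the kernel conjecture itself** (tightness of the calculus of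
`KZCalculus.lean`): the three dimension-preserving moves do not generate `ker eval`.
[cite: KontsevichZagier2001, §1.2] -/
theorem newtonLeibniz_loadBearing :
    ¬ (eval.ker ≤ AddSubgroup.closure (domainAddRel ∪ integrandAddRel ∪ changeOfVariablesRel)) := by
  intro h
  obtain ⟨ψ, hψ⟩ := exists_dimZeroValue
  obtain ⟨r₁, r₀, -, h₀, hw⟩ := exists_kernel_witness
  have hker : of r₁ - of r₀ ∈ eval.ker := by rwa [AddMonoidHom.mem_ker]
  have h0 := closure_threeMoves_le_ker ψ hψ (h hker)
  rw [AddMonoidHom.mem_ker, dimZeroValue_witness ψ hψ r₁ r₀ h₀] at h0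
  norm_num at h0

/-- **Rule 3) (Newton–Leibniz) is load-bearing for the crux `StokesGeneration`**, even in the
presence of the square relators: with `newtonLeibnizRel` removed from the generators of `relations`
(the crux's right-hand side with `relations` replaced by the closure of rules (1a), (1b), (2)) the
statement fails at the kernel element `[[0,1], 1] − [pt, 1]`. [cite: KontsevichZagier2001, §1.2] -/
theorem stokesGeneration_false_without_NL :
    ¬ (∀ x : FormalRep, eval x = 0 →
      x ∈ AddSubgroup.closure (domainAddRel ∪ integrandAddRel ∪ changeOfVariablesRel) ⊔
        AddSubgroup.closure {d : FormalRep | ∃ (U : Set (Fin 2 → ℝ)) (a b c e : (Fin 2 → ℝ) → ℝ)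
      (rB rR rT rL rW : IntegralRep 2) (rD : IntegralRep 3),
      (IsOpen U) ∧ (Set.Icc (0 : Fin 2 → ℝ) 1 ⊆ U) ∧ (∀ p ∈ U, ∀ u ∈ Set.Icc (0 : ℝ) 1, u • p ∈ U) ∧
      (ContDiffOn ℝ 1 a U) ∧ (ContDiffOn ℝ 1 b U) ∧ (ContDiffOn ℝ 1 c U) ∧ (ContDiffOn ℝ 1 e U) ∧
      (∀ p ∈ U, fderiv ℝ a p (Pi.single 1 1) = fderiv ℝ b p (Pi.single 0 1)) ∧
      (IsSemialgebraicFunOn ℚ U a) ∧ (IsSemialgebraicFunOn ℚ U b) ∧ (IsSemialgebraicFunOn ℚ U c) ∧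
      (IsSemialgebraicFunOn ℚ U e) ∧
      (IsSemialgebraicFunOn ℚ U (fun p => fderiv ℝ a p (Pi.single 0 1))) ∧
      (IsSemialgebraicFunOn ℚ U (fun p => fderiv ℝ a p (Pi.single 1 1))) ∧
      (IsSemialgebraicFunOn ℚ U (fun p => fderiv ℝ b p (Pi.single 1 1))) ∧
      (IsSemialgebraicFunOn ℚ U (fun p => fderiv ℝ c p (Pi.single 1 1))) ∧
      (IsSemialgebraicFunOn ℚ U (fun p => fderiv ℝ e p (Pi.single 0 1))) ∧
      (rB.domain = {x | ∀ i, x i ∈ Set.Ioo (0 : ℝ) 1}) ∧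
      (Set.EqOn rB.integrand (fun x => x 0 * a ![x 1 * x 0, 0] * c ![x 0, 0]) rB.domain) ∧
      (rR.domain = {x | ∀ i, x i ∈ Set.Ioo (0 : ℝ) 1}) ∧
      (Set.EqOn rR.integrand (fun x => (a ![x 1, x 1 * x 0] + x 0 * b ![x 1, x 1 * x 0]) * e ![1, x 0])
        rR.domain) ∧
      (rT.domain = {x | ∀ i, x i ∈ Set.Ioo (0 : ℝ) 1}) ∧
      (Set.EqOn rT.integrand (fun x => (x 0 * a ![x 1 * x 0, x 1] + b ![x 1 * x 0, x 1]) * c ![x 0, 1])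
        rT.domain) ∧
      (rL.domain = {x | ∀ i, x i ∈ Set.Ioo (0 : ℝ) 1}) ∧
      (Set.EqOn rL.integrand (fun x => x 0 * b ![0, x 1 * x 0] * e ![0, x 0]) rL.domain) ∧
      (rW.domain = {x | ∀ i, x i ∈ Set.Ioo (0 : ℝ) 1}) ∧
      (Set.EqOn rW.integrand (fun x => a ![x 0, x 1] * e ![x 0, x 1] - b ![x 0, x 1] * c ![x 0, x 1])
        rW.domain) ∧
      (rD.domain = {x | ∀ i, x i ∈ Set.Ioo (0 : ℝ) 1}) ∧
      (Set.EqOn rD.integrand (fun x => (x 0 * a ![x 2 * x 0, x 2 * x 1] + x 1 * b ![x 2 * x 0, x 2 * x 1]) *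
        (fderiv ℝ e ![x 0, x 1] (Pi.single 0 1) - fderiv ℝ c ![x 0, x 1] (Pi.single 1 1))) rD.domain) ∧
      d = of rB + of rR - of rT - of rL - of rW - of rD}) := by
  intro h
  obtain ⟨ψ, hψ⟩ := exists_dimZeroValue
  obtain ⟨r₁, r₀, -, h₀, hw⟩ := exists_kernel_witness
  have h0 := (sup_le (closure_threeMoves_le_ker ψ hψ) (closure_stokesSquareRel_le_ker ψ hψ)) (h _ hw)
  rw [AddMonoidHom.mem_ker, dimZeroValue_witness ψ hψ r₁ r₀ h₀] at h0
  norm_num at h0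

/-- **`relations` is load-bearing in the crux**: the square relators alone (dimensions `2`, `3`) do
not generate the kernel element `[[0,1], 1] − [pt, 1]` of dimensions `0`, `1`.
[cite: KontsevichZagier2001, §1.2] -/
theorem stokesGeneration_false_without_relations :
    ¬ (∀ x : FormalRep, eval x = 0 →
      x ∈ AddSubgroup.closure {d : FormalRep | ∃ (U : Set (Fin 2 → ℝ)) (a b c e : (Fin 2 → ℝ) → ℝ)
      (rB rR rT rL rW : IntegralRep 2) (rD : IntegralRep 3),
      (IsOpen U) ∧ (Set.Icc (0 : Fin 2 → ℝ) 1 ⊆ U) ∧ (∀ p ∈ U, ∀ u ∈ Set.Icc (0 : ℝ) 1, u • p ∈ U) ∧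
      (ContDiffOn ℝ 1 a U) ∧ (ContDiffOn ℝ 1 b U) ∧ (ContDiffOn ℝ 1 c U) ∧ (ContDiffOn ℝ 1 e U) ∧
      (∀ p ∈ U, fderiv ℝ a p (Pi.single 1 1) = fderiv ℝ b p (Pi.single 0 1)) ∧
      (IsSemialgebraicFunOn ℚ U a) ∧ (IsSemialgebraicFunOn ℚ U b) ∧ (IsSemialgebraicFunOn ℚ U c) ∧
      (IsSemialgebraicFunOn ℚ U e) ∧
      (IsSemialgebraicFunOn ℚ U (fun p => fderiv ℝ a p (Pi.single 0 1))) ∧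
      (IsSemialgebraicFunOn ℚ U (fun p => fderiv ℝ a p (Pi.single 1 1))) ∧
      (IsSemialgebraicFunOn ℚ U (fun p => fderiv ℝ b p (Pi.single 1 1))) ∧
      (IsSemialgebraicFunOn ℚ U (fun p => fderiv ℝ c p (Pi.single 1 1))) ∧
      (IsSemialgebraicFunOn ℚ U (fun p => fderiv ℝ e p (Pi.single 0 1))) ∧
      (rB.domain = {x | ∀ i, x i ∈ Set.Ioo (0 : ℝ) 1}) ∧
      (Set.EqOn rB.integrand (fun x => x 0 * a ![x 1 * x 0, 0] * c ![x 0, 0]) rB.domain) ∧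
      (rR.domain = {x | ∀ i, x i ∈ Set.Ioo (0 : ℝ) 1}) ∧
      (Set.EqOn rR.integrand (fun x => (a ![x 1, x 1 * x 0] + x 0 * b ![x 1, x 1 * x 0]) * e ![1, x 0])
        rR.domain) ∧
      (rT.domain = {x | ∀ i, x i ∈ Set.Ioo (0 : ℝ) 1}) ∧
      (Set.EqOn rT.integrand (fun x => (x 0 * a ![x 1 * x 0, x 1] + b ![x 1 * x 0, x 1]) * c ![x 0, 1])
        rT.domain) ∧
      (rL.domain = {x | ∀ i, x i ∈ Set.Ioo (0 : ℝ) 1}) ∧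
      (Set.EqOn rL.integrand (fun x => x 0 * b ![0, x 1 * x 0] * e ![0, x 0]) rL.domain) ∧
      (rW.domain = {x | ∀ i, x i ∈ Set.Ioo (0 : ℝ) 1}) ∧
      (Set.EqOn rW.integrand (fun x => a ![x 0, x 1] * e ![x 0, x 1] - b ![x 0, x 1] * c ![x 0, x 1])
        rW.domain) ∧
      (rD.domain = {x | ∀ i, x i ∈ Set.Ioo (0 : ℝ) 1}) ∧
      (Set.EqOn rD.integrand (fun x => (x 0 * a ![x 2 * x 0, x 2 * x 1] + x 1 * b ![x 2 * x 0, x 2 * x 1]) *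
        (fderiv ℝ e ![x 0, x 1] (Pi.single 0 1) - fderiv ℝ c ![x 0, x 1] (Pi.single 1 1))) rD.domain) ∧
      d = of rB + of rR - of rT - of rL - of rW - of rD}) := by
  intro h
  obtain ⟨ψ, hψ⟩ := exists_dimZeroValue
  obtain ⟨r₁, r₀, -, h₀, hw⟩ := exists_kernel_witness
  have h0 := closure_stokesSquareRel_le_ker ψ hψ (h _ hw)
  rw [AddMonoidHom.mem_ker, dimZeroValue_witness ψ hψ r₁ r₀ h₀] at h0
  norm_num at h0

end Summit.KontsevichZagierPeriods.UnfoldedStokes.StokesGenerationNegative
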